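import Mathlib
import Literature.Computability.AlgebraicComplexity.LRPencilOfMatrix
import Literature.Computability.AlgebraicComplexity.GrenetEquivariant
import Literature.Computability.AlgebraicComplexity.DetReprEquivalent
import Summits.ValiantsHypothesis.ValiantsHypothesis.Theorems.RigidMinimalRepsMinimalRepTorusSymmetricStubTightLifts

/-!
# Crux `FreeSubtorus.OrbitDimensionBound` (stmt-ValiantsHypothesis-16133), line `Sketch` —
# stub `stub_tightModLatticeLifts` (a support tight modulo a lattice `ℤΛ` has DIAGONAL exact lifts
# of the whole subtorus `T_Λ`)

Setting: an `m × m` affine determinantal representation `A` of `per_n` in the `n²` variables `x_{kl}`,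
row/column potentials `α, β : Fin m → M`, `M = ℤ^(Fin n ⊕ Fin n)` the character lattice of the two-sided
torus `T' = (ℂˣ)ⁿ × (ℂˣ)ⁿ` (`x_{kl} ↦ d_k e_l x_{kl}`), and relations `Λ : Fin r → M`.  The support of `A`
is TIGHT MODULO `ℤΛ`: a constant sits at `(i,j)` only if `α i + β j ∈ ℤΛ`, the variable `x_p` only if
`α i + β j - e_p ∈ ℤΛ` (`e_p = e_{inl p.1} + e_{inr p.2}`).  Conclusion: `A` is equivariant, with exact
`GL_m × GL_m` lifts, under the subtorus `T_Λ = closure {diag(d_k e_l) : χ_{Λ t}(d,e) = 1 ∀ t}`.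

Proof.  For `u = (d,e) : Fin n ⊕ Fin n → ℂˣ` the Laurent character `χ_v(u) = ∏_q u_q^{v q} ∈ ℂˣ` is
additive in `v` (`latticeChar_add`, `latticeChar_sum`, `latticeChar_zsmul`), `χ_{e_q} = u_q`
(`latticeChar_single`), so `χ_{Σ z_t Λ_t}(u) = ∏_t χ_{Λ_t}(u)^{z_t} = 1` on a generator of `T_Λ`.  Hence at
entry `(i,j)` the gauge factor `χ_{α i} χ_{β j} = χ_{α i + β j}` is `1` on a constant and `d_{p.1} e_{p.2}` on
`x_p`, which is exactly how the diagonal substitution acts on an affine entry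
(`RigidMinimalRepsMinimalRepTorusSymmetric.linSubst_diagonal_eq_C_mul_mul_C`): `A(γ·x) = diag(χ_{α i}) · A ·
diag(χ_{β j})`.  Exact lifts of the generators give equivariance for the closure
(`IsEquivariantDetRepr.of_generators`).  The case `Λ = 0` is
`RigidMinimalRepsMinimalRepTorusSymmetric.stub_tightLifts`; no determinant hypothesis is used beyond
`IsAffineDetRepr`.
[cite: LandsbergRessayre2017, Def. 1.3]
-/

-- Sub = Summit single-conjunct layout: the duplicated namespace component is mandated by the tree.
set_option linter.dupNamespace false

noncomputable section

namespace Summit.ValiantsHypothesis.ValiantsHypothesis.Theorems.FreeSubtorusOrbitDimensionBound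

open MvPolynomial Finset
open Literature.Computability.AlgebraicComplexity LRPencil

/-! ### Laurent characters of a torus: `χ_v(u) = ∏_q u_q ^ (v q)` -/

section Character

variable {ι G : Type*} [Fintype ι] [CommGroup G]

/-- The Laurent character `χ_v(u) = ∏_q u_q^{v q}` is additive in the weight: `χ_{a+b} = χ_a · χ_b`.
[folklore] -/
theorem latticeChar_add (u : ι → G) (a b : ι → ℤ) :
    ∏ q, u q ^ (a + b) q = (∏ q, u q ^ a q) * ∏ q, u q ^ b q := by
  simp only [Pi.add_apply, zpow_add, prod_mul_distrib]

/-- The Laurent character of a finite sum of weights is the product of the characters. [folklore] -/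
theorem latticeChar_sum {κ : Type*} (u : ι → G) (s : Finset κ) (f : κ → ι → ℤ) :
    ∏ q, u q ^ (∑ t ∈ s, f t) q = ∏ t ∈ s, ∏ q, u q ^ f t q := by
  classical
  induction s using Finset.induction_on with
  | empty => simp
  | insert t s ht ih => rw [Finset.sum_insert ht, Finset.prod_insert ht, latticeChar_add, ih]

/-- The Laurent character of an integer multiple of a weight is the power of the character. [folklore] -/
theorem latticeChar_zsmul (u : ι → G) (z : ℤ) (v : ι → ℤ) :
    ∏ q, u q ^ (z • v) q = (∏ q, u q ^ v q) ^ z := by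
  simp only [Pi.smul_apply, smul_eq_mul, zpow_mul', prod_zpow]

/-- The Laurent character of the basis weight `e_{q₀}` is the coordinate `u_{q₀}`. [folklore] -/
theorem latticeChar_single [DecidableEq ι] (u : ι → G) (q₀ : ι) :
    ∏ q, u q ^ (Pi.single q₀ 1 : ι → ℤ) q = u q₀ := by
  rw [Fintype.prod_eq_single q₀ fun q hq => by rw [Pi.single_eq_of_ne hq, zpow_zero],
    Pi.single_eq_same, zpow_one]

end Character

/-! ### The stub -/

/-- **Registered stub `stub_tightModLatticeLifts`** of line `Sketch` of crux `OrbitDimensionBound`: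
a support tight modulo the lattice `ℤΛ` has DIAGONAL exact lifts of the whole subtorus `T_Λ`.  If `A` is
an affine determinantal representation of `per_n` and `α, β : Fin m → ℤ^(Fin n ⊕ Fin n)` are potentials
such that a constant sits at `(i,j)` only if `α i + β j ∈ ℤΛ` and the variable `x_p` only if
`α i + β j - e_p ∈ ℤΛ` (`e_p = e_{inl p.1} + e_{inr p.2}`), then `A` is `T_Λ`-equivariant with exact
`GL_m × GL_m` lifts: a generator `diag(d_k e_l)` with `χ_{Λ t}(d,e) = 1` for all `t` lifts to
`(diag(χ_{α i}(d,e)), diag(χ_{β j}(d,e))⁻¹)`. [cite: LandsbergRessayre2017, Def. 1.3] -/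
theorem stub_tightModLatticeLifts :
    ∀ (n m r : ℕ) (Λ : Fin r → (Fin n ⊕ Fin n) → ℤ)
    (A : Matrix (Fin m) (Fin m) (MvPolynomial (Fin n × Fin n) ℂ))
    (α β : Fin m → (Fin n ⊕ Fin n) → ℤ),
    Literature.Computability.AlgebraicComplexity.IsAffineDetRepr
        (Literature.Computability.AlgebraicComplexity.perPoly (Fin n) ℂ) A →
    (∀ i j, Literature.Computability.AlgebraicComplexity.constPart A i j ≠ 0 →
      ∃ z : Fin r → ℤ, α i + β j = ∑ t, z t • Λ t) →
    (∀ i j (p : Fin n × Fin n),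
      Literature.Computability.AlgebraicComplexity.LRPencil.coeffMat A p i j ≠ 0 →
      ∃ z : Fin r → ℤ,
        α i + β j - ((Pi.single (Sum.inl p.1) 1 : Fin n ⊕ Fin n → ℤ) + Pi.single (Sum.inr p.2) 1) =
          ∑ t, z t • Λ t) →
    Literature.Computability.AlgebraicComplexity.IsEquivariantDetRepr
      (Subgroup.closure {γ : Matrix.GeneralLinearGroup (Fin n × Fin n) ℂ | ∃ d e : Fin n → ℂˣ,
        (∀ i, (∏ k, (d k) ^ (Λ i (Sum.inl k))) * (∏ l, (e l) ^ (Λ i (Sum.inr l))) = 1) ∧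
        (γ : Matrix (Fin n × Fin n) (Fin n × Fin n) ℂ) =
          Matrix.diagonal (fun p => (d p.1 : ℂ) * (e p.2 : ℂ))})
      (Literature.Computability.AlgebraicComplexity.perPoly (Fin n) ℂ) A := by
  intro n m r Λ A α β hA hconst hcoeff
  refine IsEquivariantDetRepr.of_generators hA fun γ hγ => ?_
  obtain ⟨d, e, hrel, hγ⟩ := hγ
  -- the torus element as one family of units `u = (d, e)` indexed by `Fin n ⊕ Fin n`
  set u : Fin n ⊕ Fin n → ℂˣ := Sum.elim d e with hu
  -- the relations: `χ_{Λ t}(u) = 1`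
  have hΛ : ∀ t, ∏ q, u q ^ Λ t q = 1 := fun t => by
    rw [Fintype.prod_sum_type]
    simpa only [hu, Sum.elim_inl, Sum.elim_inr] using hrel t
  -- hence `χ` is trivial on the lattice `ℤΛ`
  have hχΛ : ∀ z : Fin r → ℤ, ∏ q, u q ^ (∑ t, z t • Λ t) q = 1 := fun z => by
    rw [latticeChar_sum]
    exact Finset.prod_eq_one fun t _ => by rw [latticeChar_zsmul, hΛ t, one_zpow]
  -- the diagonal lift `(diag χ_{α i}, (diag χ_{β j})⁻¹)`
  refine ⟨diagUnit ℂ (fun i => ((∏ q, u q ^ α i q : ℂˣ) : ℂ)) (fun i => Units.ne_zero _),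
    (diagUnit ℂ (fun j => ((∏ q, u q ^ β j q : ℂˣ) : ℂ)) (fun j => Units.ne_zero _))⁻¹, ?_⟩
  rw [inv_inv]
  refine Matrix.ext fun i j => ?_
  rw [Matrix.linSubstEntries_apply, hγ, coe_diagUnit, coe_diagUnit, Matrix.diagonal_map C_0,
    Matrix.diagonal_map C_0, Matrix.mul_diagonal, Matrix.diagonal_mul]
  refine RigidMinimalRepsMinimalRepTorusSymmetric.linSubst_diagonal_eq_C_mul_mul_C (A i j) (hA.1 i j)
    _ _ _ (fun h0 => ?_) (fun v hv => ?_)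
  · -- constant term present: `χ_{α i} χ_{β j} = χ_{α i + β j} = χ_{Σ z•Λ} = 1`
    have h0' : constPart A i j ≠ 0 := by rwa [constPart_apply, constantCoeff_eq]
    obtain ⟨z, hz⟩ := hconst i j h0'
    rw [← Units.val_mul, ← latticeChar_add, hz, hχΛ z, Units.val_one]
  · -- `x_v` present: `χ_{α i} χ_{β j} = χ_{Σ z•Λ} χ_{e_v} = d_{v.1} e_{v.2}`
    have hv' : coeffMat A v i j ≠ 0 := by rwa [coeffMat_apply]
    obtain ⟨z, hz⟩ := hcoeff i j v hv'
    rw [sub_eq_iff_eq_add] at hz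
    have key : (∏ q, u q ^ α i q) * ∏ q, u q ^ β j q = d v.1 * e v.2 := by
      rw [← latticeChar_add, hz, latticeChar_add, hχΛ z, one_mul, latticeChar_add,
        latticeChar_single, latticeChar_single, hu, Sum.elim_inl, Sum.elim_inr]
    rw [← Units.val_mul, key, Units.val_mul]

end Summit.ValiantsHypothesis.ValiantsHypothesis.Theorems.FreeSubtorusOrbitDimensionBound

end
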